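import Literature.NumberTheory.LFunctions.AlternativeHypothesisFormFactorProofs
import HarnessLib

/-!
# BGSTB 2025, Lemma 5 (Heath-Brown) (iii)–(iv) — UNIFORMLY in the AH-Pairs level `M` (row «U»)

Topic `Literature/NumberTheory/LFunctions` (namespace `Literature.NumberTheory.LFunctions`; helpers in
the sub-namespace `AH`). PROOF LAYER, theorems only (no definitions, no named facts), cell `rh-crit/ah`
(C5, seat t5, row «U»). LABEL: **NOT RH-BEARING** — everything here is a CONDITIONAL
`RiemannHypothesis → (AH-Pairs data) → …`; RH and AH-Pairs stay hypotheses and nothing here bears on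
the truth of either.

S. A. C. Baluyot, D. A. Goldston, A. I. Suriajaya, C. L. Turnage-Butterbaugh, *The Alternative
Hypothesis for zeros of the Riemann zeta-function*, arXiv:2508.10857 (2025), §5, **Lemma 5
(Heath-Brown) (iii)–(iv)**: "Assuming AH-Pairs, we have
(iii) `G_λ(α) = ∑_{k∈ℤ} e^{iπkα} (sin(λπk/2)/(λπk/2))² P_{k/2} + O(E_G(λ, α))`, and for `L ∈ ℤ`,
(iv) `G_λ(α + 2L) = G_λ(α) + O(E_G(λ, |α| + 2L))`", `E_G(λ, α) = 1/(λ²M) + (|α| + 1)M²R(T) + 1/log T`,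
with ABSOLUTE implied constants — the dependence on the AH-Pairs level `𝓜 = M` is carried by `E_G`
itself (§5, display (E_G), p. 12 of the held text).

## Why this file exists (the M-uniformity of the tail constant)

The tree's `AH.heathBrownG_approx` / `bgstb2025_lemma5_ah_of_RH`
(`AlternativeHypothesisFormFactorProofs`) prove (iii)–(iv) in the shape
`∀ M, 0 < M → ∀ R, IsPairsRate M R → ∀ δ … → ∃ C, ∀ᶠ T, … ≤ C · E_G(λ, α)`, and the constant `C`
produced there grows like `M³` and multiplies the whole of `E_G`, including the tail `1/(λ²M)`: the
bound on the pairs outside `𝒫(T, M)` carries no decay in `M` (the shells `3y₀ < |y| ≲ log T` are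
summed from `3y₀`, not from `M`, and the far pairs `|γ − γ'| ≳ 2` are counted in windows of length
`1/log T`). Theorem 3 of the source lets `T → ∞` and then needs the AH level `M → ∞` with `λ → 0`,
which requires the coefficient of `1/(λ²M)` to be ABSOLUTE, as printed. This file re-proves
(iii)–(iv) with the constants SPLIT accordingly (new theorems; nothing landed is edited):

`AH.heathBrownG_approx_usplit : RiemannHypothesis → ∃ A > 0, ∀ M > 0, ∀ R, AH.IsPairsRate M R →
∀ δ ∈ (0, 1/2], ∃ C > 0, ∀ᶠ T, ∀ λ ∈ (0, 1/2], ∀ α,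
‖G_λ(α) − ∑_k e^{iπkα} sinc²(λπk/2) P_{k/2}(T)‖ ≤ A/(λ²M) + C((|α| + 1)M²R(T) + 1/log T)`

— `A` depends only on the RH pair-window constants (`RudnickSarnak.exists_pairCount_window_le`) and
the unconditional zero-counting constants; `C` (after the AH data) multiplies only quantities that
tend to `0` as `T → ∞`. `bgstb2025_lemma5_ah_usplit` adds (iv) (with `|L|`, as in the tree's corrected
form), and `bgstb2025_lemma5_ah_usplit_errG` repackages the split bound as ONE `E_G` with ABSOLUTE
leading constant `1` for the RESCALED parameters `(M', R') = (M/A, C(R + 1/log T))`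
(`AH.split_le_errG_one`), so that proofs written against the shape `C₂ · AH.errG M (R T) T λ α` can be
re-run verbatim on the uniform input with `C₂ = 1` (the `M`-dependence sits in the `T`-vanishing
rate `R'` only).

## The printed proof (§5) and what changes relative to `AH.heathBrownG_approx`

Steps (G_λ2), the `L¹`-Lipschitz phase/kernel bound, the localisation on `𝒫(T, M) = ⊔_k B_{k/2}`
and `|𝒫(T, M)| ≪ M T log T` are reused from the tree unchanged (`AH.heathBrownG_mul_eq_sum`,
`AH.norm_fourier_fejerTest_sub_le`, `AH.norm_sum_pairs_sub_sum_bins_le`, `AH.card_pairs_le_window`);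
their constants legitimately depend on `M` and multiply `(|α|+1)M²R(T)` and `M²/log²T` only. The
pairs OUTSIDE `𝒫(T, M)` ("`≪ ((T/2π) log T)⁻¹ ∑_{|y|>M} 1/(λ²y²) ≪ 1/(λ²M)`", printed p. 13) are
re-counted (`AH.sum_sdiff_pairs_le_usplit`): low pairs `O(T)` (unit windows, as before);
`M < |y| ≤ 3y₀`: `≤ 8C_w T log T` pairs of weight `≤ 1/(λ²M)`; shells `max(M, 3y₀) < |y| ≲ log T`:
`RudnickSarnak.sum_filter_mid_le` started at `Y = max(M, 3y₀)` (`≤ 24 C_w T log T/(y₀λ²M)`); far pairs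
`|γ − γ'| > 3/2`: unit windows in `γ` row by row with the decay `(1 + (log T/2π)|γ − γ'|)⁻²`
(`≤ 512π² C_N C₁ T/λ²`, i.e. `O(1/(λ² log T))` after normalisation, absorbed into `A/(λ²M)` for
`log T ≥ M`). So `A = 2π(8C_w + 24C_w/y₀ + 512π²C_N C₁) + 1`.

## References

* [BaluyotGoldstonSuriajayaTurnageButterbaugh2025] arXiv:2508.10857, §5: (G_λ), (K-Fejer), (G_λ2),
  (E_G), Lemma 5, proof of (iii)–(iv) (held text `paper:arxiv-2508.10857`, p0012–p0013); §3
  (zeropairbound), (P-bound) (p0009).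
* [GoldstonMontgomery1987] D. A. Goldston, H. L. Montgomery, *Pair correlation of zeros and primes in
  short intervals*, Progr. Math. 70 (1987) — the RH pair count (zeropairbound).
* [Montgomery1973] H. L. Montgomery, Proc. Sympos. Pure Math. 24 (1973) (the pair-window count used
  here is the tree's corollary of Montgomery's theorem).
* Cell record: `run/shared/lean/pub/rh-crit/ah/MEMO-t5-UniformAH.md` (row «U» specification).
-/

noncomputable section

open scoped Real Topology FourierTransform
open Filter Set MeasureTheory Asymptotics

namespace Literature.NumberTheory.LFunctions

namespace AH

/-! ## U1. The far pairs `|γ − γ'| > 3/2`: unit windows in `γ`, row by row, with decay -/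

/-- Row sums over the far pairs: for a fixed zero `γ_i`,
`∑_{γ_j : 3/2 < |γ_i − γ_j| ≤ T} (1 + |γ_i − γ_j|)⁻² ≤ 8 C₁ log T` when every unit window holds at most
`C₁ log T` ordinates (shells of width `1/2`, `RudnickSarnak.sum_filter_mid_le`). [folklore] -/
private theorem sum_row_far_le {T K : ℝ} (hK : 0 ≤ K)
    (hunit : ∀ a : ℝ, (((Finset.range (zetaZeroCount T)).filter fun c ↦
      a ≤ zetaOrdinate c ∧ zetaOrdinate c ≤ a + 1).card : ℝ) ≤ K) (i : ℕ) :
    ∑ j ∈ zeroIndexSet T with 3 / 2 < |zetaOrdinate i - zetaOrdinate j| ∧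
        |zetaOrdinate i - zetaOrdinate j| ≤ T,
      ((1 + |zetaOrdinate i - zetaOrdinate j|) ^ 2)⁻¹ ≤ 8 * K := by
  have hwin : ∀ s : ℝ, |s| + 1 / 2 ≤ (T / (1 / 2) + 5 / 2) * (1 / 2) →
      (((zeroIndexSet T).filter fun j ↦
          |zetaOrdinate i - zetaOrdinate j - s| ≤ 1 / 2).card : ℝ) ≤ K := by
    intro s _
    have hsub : ((zeroIndexSet T).filter fun j ↦ |zetaOrdinate i - zetaOrdinate j - s| ≤ 1 / 2) ⊆
        ((Finset.range (zetaZeroCount T)).filter fun c ↦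
          zetaOrdinate i - s - 1 / 2 ≤ zetaOrdinate c ∧
            zetaOrdinate c ≤ zetaOrdinate i - s - 1 / 2 + 1) := by
      intro j hj
      rw [Finset.mem_filter] at hj ⊢
      obtain ⟨h1, h2⟩ := abs_le.mp hj.2
      exact ⟨hj.1, by linarith, by linarith⟩
    calc (((zeroIndexSet T).filter fun j ↦
          |zetaOrdinate i - zetaOrdinate j - s| ≤ 1 / 2).card : ℝ)
        ≤ (((Finset.range (zetaZeroCount T)).filter fun c ↦
            zetaOrdinate i - s - 1 / 2 ≤ zetaOrdinate c ∧
              zetaOrdinate c ≤ zetaOrdinate i - s - 1 / 2 + 1).card : ℝ) := by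
          exact_mod_cast Finset.card_le_card hsub
      _ ≤ K := hunit _
  have h := RudnickSarnak.sum_filter_mid_le (zeroIndexSet T)
    (fun j ↦ zetaOrdinate i - zetaOrdinate j) (y₀ := 1 / 2) (Y := 3 / 2) (B := T)
    (R := (T / (1 / 2) + 5 / 2) * (1 / 2)) (M := K)
    (by norm_num) (by norm_num) hK hwin le_rfl
  refine h.trans (le_of_eq ?_)
  ring

/-! ## U2. The pairs outside `𝒫(T, M)`, with the `M`-decay of the tail kept -/

set_option maxHeartbeats 1600000 in
/-- **The pairs outside `𝒫(T, M)`, uniformly in `M`** (BGSTB 2025, §5, proof of Lemma 5 (iii):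
"the terms with `γ ≤ T/log²T` or `γ' ≤ T/log²T` contribute `O(1/log T)`", and those with `|y| > M`
contribute "`≪ ((T/2π) log T)⁻¹ ∑_{|y|>M} 1/(λ²y²) ≪ 1/(λ²M)`" by (zeropairbound) — Goldston–Montgomery,
under RH): for a weight `0 ≤ Φ ≤ min(1, 4λ⁻²(1 + |y|)⁻²)`,
`∑_{Ω ∖ 𝒫(T,M)} Φ ≤ 12 C_N C₀ T + (8C_w + 24C_w/y₀) T log T/(λ²M) + 512π² C_N C₁ T/λ²`:
low pairs; `M < |y| ≤ 3y₀` (`≤ 8C_w T log T` pairs, weight `≤ 1/(λ²M)`); shells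
`max(M, 3y₀) < |y| ≤ log T/π − 3y₀` summed from `max(M, 3y₀)`; far pairs by unit windows in `γ` with
the decay `(1 + (log T/2π)|γ − γ'|)⁻²`. [cite: BaluyotGoldstonSuriajayaTurnageButterbaugh2025, §5 (proof of Lemma 5)] -/
theorem sum_sdiff_pairs_le_usplit {T M lam y₀ C_w C₁ C₀ CN : ℝ} (hM : 0 < M) (hlam : 0 < lam)
    (hy₀ : 0 < y₀) (hCw : 0 ≤ C_w) (hC₁ : 0 ≤ C₁) (hC₀ : 0 ≤ C₀) (hCN : 0 ≤ CN)
    (hwin : ∀ s : ℝ, |s| + y₀ ≤ Real.log T / π →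
      (((zeroIndexSet T ×ˢ zeroIndexSet T).filter fun p ↦
          |Real.log T / (2 * π) * (zetaOrdinate p.1 - zetaOrdinate p.2) - s| ≤ y₀).card : ℝ) ≤
        C_w * (T * Real.log T))
    (hunit : ∀ a : ℝ, (((Finset.range (zetaZeroCount T)).filter fun c ↦
      a ≤ zetaOrdinate c ∧ zetaOrdinate c ≤ a + 1).card : ℝ) ≤ C₁ * Real.log T)
    (hW : ∀ u : ℝ, (zetaZeroCount (u + 1) : ℝ) - zetaZeroCount u ≤ C₀ * Real.log (|u| + 2))
    (hN : ∀ u : ℝ, 2 ≤ u → (zetaZeroCount u : ℝ) ≤ CN * (u * Real.log u))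
    (hT4 : 4 ≤ T) (hLM : 2 * π * M ≤ Real.log T) (hLy : 2 * π * (3 * y₀ + 2) ≤ Real.log T)
    (hLy2 : 12 * π * y₀ ≤ Real.log T) (hu1 : 1 ≤ T / Real.log T ^ 2)
    (Φ : ℕ × ℕ → ℝ) (hΦ0 : ∀ p, 0 ≤ Φ p) (hΦ1 : ∀ p, Φ p ≤ 1)
    (hΦ2 : ∀ p, Φ p ≤ 4 / lam ^ 2 * ((1 + |pairSpacing T p|) ^ 2)⁻¹) :
    ∑ p ∈ (zeroIndexSet T ×ˢ zeroIndexSet T) \ pairs T M, Φ p ≤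
      12 * CN * C₀ * T + (8 * C_w + 24 * C_w / y₀) * (T * Real.log T) / (lam ^ 2 * M) +
        512 * π ^ 2 * CN * C₁ * T / lam ^ 2 := by
  have hT0 : 0 < T := by linarith
  have hT1 : 1 < T := by linarith
  have hL : 0 < Real.log T := Real.log_pos hT1
  set L : ℝ := Real.log T with hLdef
  have hL2π : 2 * π ≤ L := by nlinarith [Real.pi_pos]
  have hL2 : 2 ≤ L := by linarith [Real.pi_gt_three]
  set c : ℝ := L / (2 * π) with hc
  have hc0 : 0 < c := by positivity
  set Z := zeroIndexSet T with hZ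
  set Ω := zeroIndexSet T ×ˢ zeroIndexSet T with hΩ
  set yM : ℕ × ℕ → ℝ := fun p ↦ c * (zetaOrdinate p.1 - zetaOrdinate p.2) with hyM
  have hyeq : ∀ p, pairSpacing T p = yM p := fun p ↦ pairSpacing_eq T p
  -- the cut and the ranges
  set u : ℝ := T / L ^ 2 with hu
  set BT : ℝ := L / π - 3 * y₀ with hBT
  have hcπ : L / π = 2 * c := by rw [hc]; ring
  have hBTc : 3 / 2 * c ≤ BT := by
    rw [hBT, hcπ]
    have : 6 * y₀ ≤ c := by rw [hc, le_div_iff₀ (by positivity)]; linarith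
    linarith
  set Y : ℝ := max M (3 * y₀) with hY
  have hY3 : 3 * y₀ ≤ Y := le_max_right _ _
  have hYM : M ≤ Y := le_max_left _ _
  have hY2 : M / 3 ≤ Y - 2 * y₀ := by
    rcases le_total M (3 * y₀) with h | h
    · rw [hY, max_eq_right h]; linarith
    · rw [hY, max_eq_left h]; linarith
  have hwin' : ∀ s : ℝ, |s| + y₀ ≤ L / π →
      ((Ω.filter fun p ↦ |yM p - s| ≤ y₀).card : ℝ) ≤ C_w * (T * L) := hwin
  -- decomposition
  set A := Ω.filter fun p ↦ |yM p| ≤ M ∧ (zetaOrdinate p.1 ≤ u ∨ zetaOrdinate p.2 ≤ u) with hA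
  set B₁ := Ω.filter fun p ↦ M < |yM p| ∧ |yM p| ≤ 3 * y₀ with hB₁
  set B₂ := Ω.filter fun p ↦ Y < |yM p| ∧ |yM p| ≤ BT with hB₂
  set Cfar := Ω.filter fun p ↦ BT < |yM p| with hCfar
  have hcover : Ω \ pairs T M ⊆ (A ∪ B₁) ∪ (B₂ ∪ Cfar) := by
    intro p hp
    rw [Finset.mem_sdiff] at hp
    obtain ⟨hpΩ, hpP⟩ := hp
    rw [mem_pairs, hyeq, not_and] at hpP
    have hnot := hpP hpΩ
    rw [Finset.mem_union, Finset.mem_union, Finset.mem_union, hA, hB₁, hB₂, hCfar, Finset.mem_filter,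
      Finset.mem_filter, Finset.mem_filter, Finset.mem_filter]
    by_cases hyMle : |yM p| ≤ M
    · left; left
      refine ⟨hpΩ, hyMle, ?_⟩
      by_contra hcon
      push Not at hcon
      exact hnot ⟨by rw [← hu]; exact hcon.1, by rw [← hu]; exact hcon.2, hyMle⟩
    · push Not at hyMle
      by_cases hy3 : |yM p| ≤ 3 * y₀
      · left; right; exact ⟨hpΩ, hyMle, hy3⟩
      · push Not at hy3
        by_cases hyB : |yM p| ≤ BT
        · right; left; exact ⟨hpΩ, max_lt hyMle hy3, hyB⟩
        · push Not at hyB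
          right; right; exact ⟨hpΩ, hyB⟩
  have hmain : ∑ p ∈ Ω \ pairs T M, Φ p ≤
      (∑ p ∈ A, Φ p + ∑ p ∈ B₁, Φ p) + (∑ p ∈ B₂, Φ p + ∑ p ∈ Cfar, Φ p) := by
    calc ∑ p ∈ Ω \ pairs T M, Φ p ≤ ∑ p ∈ (A ∪ B₁) ∪ (B₂ ∪ Cfar), Φ p :=
          Finset.sum_le_sum_of_subset_of_nonneg hcover fun p _ _ ↦ hΦ0 p
      _ ≤ ∑ p ∈ A ∪ B₁, Φ p + ∑ p ∈ B₂ ∪ Cfar, Φ p := RudnickSarnak.sum_union_le_add _ _ hΦ0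
      _ ≤ _ := add_le_add (RudnickSarnak.sum_union_le_add _ _ hΦ0)
          (RudnickSarnak.sum_union_le_add _ _ hΦ0)
  -- (a) the low pairs: `O(T)`
  have hAcard : (A.card : ℝ) ≤ 12 * CN * C₀ * T := by
    have hclose : ∀ p ∈ A, |zetaOrdinate p.1 - zetaOrdinate p.2| ≤ 1 := by
      intro p hp
      rw [hA, Finset.mem_filter] at hp
      have h1 : |yM p| ≤ M := hp.2.1
      rw [hyM] at h1; dsimp only at h1
      rw [abs_mul, abs_of_pos hc0] at h1
      have h2 : c * |zetaOrdinate p.1 - zetaOrdinate p.2| ≤ c * 1 := by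
        rw [mul_one]
        refine h1.trans ?_
        rw [hc, le_div_iff₀ (by positivity)]; linarith
      exact le_of_mul_le_mul_left h2 hc0
    have hoff : ∀ p ∈ A, zetaOrdinate p.1 ≤ u ∨ zetaOrdinate p.2 ≤ u := fun p hp ↦ by
      rw [hA, Finset.mem_filter] at hp; exact hp.2.2
    have h1 := card_pairs_offWindow_le hC₀ hW hT0.le (Finset.filter_subset _ _) hclose hoff
    have hu2 : 2 ≤ u + 1 := by linarith
    have huT : u + 1 ≤ T := by
      rw [hu]
      have : T / L ^ 2 ≤ T / 4 := by
        apply div_le_div_of_nonneg_left hT0.le (by norm_num)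
        nlinarith
      linarith
    have hNu : (zetaZeroCount (u + 1) : ℝ) ≤ 2 * CN * T / L := by
      refine (hN (u + 1) hu2).trans ?_
      have hlog : Real.log (u + 1) ≤ L := Real.log_le_log (by linarith) huT
      have hlog0 : 0 ≤ Real.log (u + 1) := Real.log_nonneg (by linarith)
      calc CN * ((u + 1) * Real.log (u + 1)) ≤ CN * ((2 * u) * L) := by
            apply mul_le_mul_of_nonneg_left _ hCN
            exact mul_le_mul (by linarith) hlog hlog0 (by linarith)
        _ = 2 * CN * T / L := by rw [hu]; field_simp
    have hlog4 : Real.log (T + 4) ≤ 2 * L := by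
      have h2 : T + 4 ≤ T ^ 2 := by nlinarith
      calc Real.log (T + 4) ≤ Real.log (T ^ 2) := Real.log_le_log (by linarith) h2
        _ = 2 * L := by rw [Real.log_pow]; push_cast; rw [hLdef]
    calc (A.card : ℝ) ≤ zetaZeroCount (u + 1) * (3 * C₀ * Real.log (T + 4)) := h1
      _ ≤ (2 * CN * T / L) * (3 * C₀ * (2 * L)) := by
          have hl0 : 0 ≤ Real.log (T + 4) := Real.log_nonneg (by linarith)
          apply mul_le_mul hNu (by nlinarith) (by positivity) (by positivity)
      _ = 12 * CN * C₀ * T := by field_simp; ring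
  have hAsum : ∑ p ∈ A, Φ p ≤ 12 * CN * C₀ * T := by
    calc ∑ p ∈ A, Φ p ≤ ∑ p ∈ A, (1 : ℝ) := Finset.sum_le_sum fun p _ ↦ hΦ1 p
      _ = A.card := by rw [Finset.sum_const, nsmul_eq_mul, mul_one]
      _ ≤ 12 * CN * C₀ * T := hAcard
  -- (b₁) the pairs with `M < |y| ≤ 3 y₀`: `≤ 8 C_w T L` of them, each of weight `≤ 1/(λ² M)`
  have hB₁sum : ∑ p ∈ B₁, Φ p ≤ 8 * C_w * (T * L) / (lam ^ 2 * M) := by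
    have hR : (3 * y₀ / y₀ + 5 / 2) * y₀ ≤ L / π := by
      have : (3 * y₀ / y₀ + 5 / 2) * y₀ = 11 / 2 * y₀ := by field_simp; ring
      rw [this]
      have h2 : 2 * (3 * y₀ + 2) ≤ L / π := by rw [le_div_iff₀ Real.pi_pos]; linarith
      linarith
    have h := RudnickSarnak.card_filter_abs_le_le Ω yM hy₀ (by positivity : (0 : ℝ) ≤ 3 * y₀) hwin' hR
    have hfl : (⌊3 * y₀ / y₀⌋₊ : ℝ) = 3 := by
      rw [show 3 * y₀ / y₀ = (3 : ℝ) by field_simp]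
      norm_num
    have hsub : B₁ ⊆ Ω.filter fun p ↦ |yM p| ≤ 3 * y₀ := by
      intro p hp
      rw [hB₁, Finset.mem_filter] at hp
      exact Finset.mem_filter.mpr ⟨hp.1, hp.2.2⟩
    have hcard : (B₁.card : ℝ) ≤ 8 * C_w * (T * L) := by
      calc (B₁.card : ℝ) ≤ ((Ω.filter fun p ↦ |yM p| ≤ 3 * y₀).card : ℝ) := by
            exact_mod_cast Finset.card_le_card hsub
        _ ≤ 2 * (C_w * (T * L)) * (⌊3 * y₀ / y₀⌋₊ + 1) := h
        _ = 8 * C_w * (T * L) := by rw [hfl]; ring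
    have hwt : ∀ p ∈ B₁, Φ p ≤ 1 / (lam ^ 2 * M) := by
      intro p hp
      rw [hB₁, Finset.mem_filter] at hp
      have hy : M < |yM p| := hp.2.1
      refine (hΦ2 p).trans ?_
      rw [hyeq]
      have h4 : 4 * M ≤ (1 + |yM p|) ^ 2 := by
        nlinarith [abs_nonneg (yM p), sq_nonneg (1 - |yM p|)]
      calc 4 / lam ^ 2 * ((1 + |yM p|) ^ 2)⁻¹ = 4 / (lam ^ 2 * (1 + |yM p|) ^ 2) := by
            field_simp
        _ ≤ 4 / (lam ^ 2 * (4 * M)) := by gcongr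
        _ = 1 / (lam ^ 2 * M) := by field_simp
    calc ∑ p ∈ B₁, Φ p ≤ ∑ p ∈ B₁, 1 / (lam ^ 2 * M) := Finset.sum_le_sum hwt
      _ = B₁.card * (1 / (lam ^ 2 * M)) := by rw [Finset.sum_const, nsmul_eq_mul]
      _ ≤ 8 * C_w * (T * L) * (1 / (lam ^ 2 * M)) :=
          mul_le_mul_of_nonneg_right hcard (by positivity)
      _ = 8 * C_w * (T * L) / (lam ^ 2 * M) := by rw [mul_one_div]
  -- (b₂) the shells `max(M, 3y₀) < |y| ≤ BT`, summed from `max(M, 3y₀)`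
  have hB₂sum : ∑ p ∈ B₂, Φ p ≤ 24 * C_w / y₀ * (T * L) / (lam ^ 2 * M) := by
    have hR : (BT / y₀ + 5 / 2) * y₀ ≤ L / π := by
      have : (BT / y₀ + 5 / 2) * y₀ = BT + 5 / 2 * y₀ := by field_simp
      rw [this, hBT]; linarith
    have hmid := RudnickSarnak.sum_filter_mid_le Ω yM hy₀ hY3
      (by positivity : (0 : ℝ) ≤ C_w * (T * L)) hwin' hR
    have hden : 2 * (C_w * (T * L)) / (y₀ * (Y - 2 * y₀)) ≤ 6 * C_w * (T * L) / (y₀ * M) := by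
      have hY2' : 0 < Y - 2 * y₀ := by linarith
      rw [div_le_div_iff₀ (by positivity) (by positivity)]
      have h0 : 0 ≤ C_w * (T * L) * y₀ := by positivity
      nlinarith [mul_le_mul_of_nonneg_left hY2 h0]
    calc ∑ p ∈ B₂, Φ p ≤ ∑ p ∈ B₂, 4 / lam ^ 2 * ((1 + |yM p|) ^ 2)⁻¹ := by
          refine Finset.sum_le_sum fun p _ ↦ ?_
          rw [← hyeq]; exact hΦ2 p
      _ = 4 / lam ^ 2 * ∑ p ∈ B₂, ((1 + |yM p|) ^ 2)⁻¹ := by rw [Finset.mul_sum]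
      _ ≤ 4 / lam ^ 2 * (6 * C_w * (T * L) / (y₀ * M)) := by
          apply mul_le_mul_of_nonneg_left _ (by positivity)
          rw [hB₂]
          exact hmid.trans hden
      _ = 24 * C_w / y₀ * (T * L) / (lam ^ 2 * M) := by field_simp; ring
  -- (c) the far range `|y| > BT` (so `|γ − γ'| > 3/2`), by unit windows in `γ` row by row
  have hCsum : ∑ p ∈ Cfar, Φ p ≤ 512 * π ^ 2 * CN * C₁ * T / lam ^ 2 := by
    have hCL : 0 ≤ C₁ * L := by positivity
    -- comparison of the weights: `(1 + |y|)² ≥ (c/2)² (1 + |γ − γ'|)²` once `|γ − γ'| ≥ 1`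
    have hwt : ∀ p ∈ Cfar, ((1 + |yM p|) ^ 2)⁻¹ ≤
        4 / c ^ 2 * ((1 + |zetaOrdinate p.1 - zetaOrdinate p.2|) ^ 2)⁻¹ := by
      intro p hp
      rw [hCfar, Finset.mem_filter] at hp
      have hy : BT < |yM p| := hp.2
      have hg0 : 0 ≤ |zetaOrdinate p.1 - zetaOrdinate p.2| := abs_nonneg _
      have hyg : |yM p| = c * |zetaOrdinate p.1 - zetaOrdinate p.2| := by
        rw [hyM]; dsimp only; rw [abs_mul, abs_of_pos hc0]
      rw [hyg] at hy ⊢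
      set g : ℝ := |zetaOrdinate p.1 - zetaOrdinate p.2| with hg
      have hg1 : 3 / 2 ≤ g := by
        by_contra hcon
        push Not at hcon
        have := mul_lt_mul_of_pos_left hcon hc0
        linarith
      have hpos : 0 < (1 + c * g) ^ 2 := by positivity
      have hkey : c * (1 + g) ≤ 2 * (1 + c * g) := by
        nlinarith [mul_nonneg hc0.le (by linarith : (0 : ℝ) ≤ g - 1)]
      have hsq : c ^ 2 * (1 + g) ^ 2 ≤ 4 * (1 + c * g) ^ 2 := by
        have h := mul_self_le_mul_self (by positivity : 0 ≤ c * (1 + g)) hkey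
        nlinarith [h]
      calc ((1 + c * g) ^ 2)⁻¹ = 1 / (1 + c * g) ^ 2 := inv_eq_one_div _
        _ ≤ 4 / (c ^ 2 * (1 + g) ^ 2) := by
            rw [div_le_div_iff₀ hpos (by positivity)]
            linarith [hsq]
        _ = 4 / c ^ 2 * ((1 + g) ^ 2)⁻¹ := by rw [← div_div, div_eq_mul_inv]
    -- row sums
    have hrow : ∀ i ∈ Z, ∑ j ∈ Z with BT < |yM (i, j)|, ((1 + |yM (i, j)|) ^ 2)⁻¹ ≤
        4 / c ^ 2 * (8 * (C₁ * L)) := by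
      intro i hi
      have hsub : (Z.filter fun j ↦ BT < |yM (i, j)|) ⊆
          (Z.filter fun j ↦ 3 / 2 < |zetaOrdinate i - zetaOrdinate j| ∧
            |zetaOrdinate i - zetaOrdinate j| ≤ T) := by
        intro j hj
        rw [Finset.mem_filter] at hj ⊢
        refine ⟨hj.1, ?_, ?_⟩
        · have hy : BT < |yM (i, j)| := hj.2
          have hyg : |yM (i, j)| = c * |zetaOrdinate i - zetaOrdinate j| := by
            rw [hyM]; dsimp only; rw [abs_mul, abs_of_pos hc0]
          rw [hyg] at hy
          by_contra hcon
          push Not at hcon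
          have := mul_le_mul_of_nonneg_left hcon hc0.le
          linarith
        · have hp : (i, j) ∈ zeroIndexSet T ×ˢ zeroIndexSet T := Finset.mem_product.mpr ⟨hi, hj.1⟩
          exact abs_sub_zetaOrdinate_le hp
      calc ∑ j ∈ Z with BT < |yM (i, j)|, ((1 + |yM (i, j)|) ^ 2)⁻¹
          ≤ ∑ j ∈ Z with BT < |yM (i, j)|,
              4 / c ^ 2 * ((1 + |zetaOrdinate i - zetaOrdinate j|) ^ 2)⁻¹ := by
            refine Finset.sum_le_sum fun j hj ↦ ?_
            have hp : (i, j) ∈ Cfar := by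
              rw [hCfar, Finset.mem_filter, hΩ, Finset.mem_product]
              rw [Finset.mem_filter] at hj
              exact ⟨⟨hi, hj.1⟩, hj.2⟩
            exact hwt (i, j) hp
        _ ≤ ∑ j ∈ Z with 3 / 2 < |zetaOrdinate i - zetaOrdinate j| ∧
              |zetaOrdinate i - zetaOrdinate j| ≤ T,
              4 / c ^ 2 * ((1 + |zetaOrdinate i - zetaOrdinate j|) ^ 2)⁻¹ :=
            Finset.sum_le_sum_of_subset_of_nonneg hsub fun j _ _ ↦ by positivity
        _ = 4 / c ^ 2 * ∑ j ∈ Z with 3 / 2 < |zetaOrdinate i - zetaOrdinate j| ∧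
              |zetaOrdinate i - zetaOrdinate j| ≤ T,
              ((1 + |zetaOrdinate i - zetaOrdinate j|) ^ 2)⁻¹ := by rw [Finset.mul_sum]
        _ ≤ 4 / c ^ 2 * (8 * (C₁ * L)) := by
            apply mul_le_mul_of_nonneg_left _ (by positivity)
            rw [hZ]
            exact sum_row_far_le hCL hunit i
    have hCfar_sum : ∑ p ∈ Cfar, ((1 + |yM p|) ^ 2)⁻¹ ≤ zetaZeroCount T * (4 / c ^ 2 * (8 * (C₁ * L))) := by
      have e : ∑ p ∈ Cfar, ((1 + |yM p|) ^ 2)⁻¹ =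
          ∑ i ∈ Z, ∑ j ∈ Z with BT < |yM (i, j)|, ((1 + |yM (i, j)|) ^ 2)⁻¹ := by
        rw [hCfar, Finset.sum_filter, hΩ, Finset.sum_product]
        refine Finset.sum_congr rfl fun i _ ↦ ?_
        rw [Finset.sum_filter]
      rw [e]
      calc ∑ i ∈ Z, ∑ j ∈ Z with BT < |yM (i, j)|, ((1 + |yM (i, j)|) ^ 2)⁻¹
          ≤ ∑ i ∈ Z, 4 / c ^ 2 * (8 * (C₁ * L)) := Finset.sum_le_sum hrow
        _ = zetaZeroCount T * (4 / c ^ 2 * (8 * (C₁ * L))) := by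
            rw [Finset.sum_const, nsmul_eq_mul, hZ, card_zeroIndexSet]
    have hNT : (zetaZeroCount T : ℝ) ≤ CN * (T * L) := hN T (by linarith)
    calc ∑ p ∈ Cfar, Φ p ≤ ∑ p ∈ Cfar, 4 / lam ^ 2 * ((1 + |yM p|) ^ 2)⁻¹ := by
          refine Finset.sum_le_sum fun p _ ↦ ?_
          rw [← hyeq]; exact hΦ2 p
      _ = 4 / lam ^ 2 * ∑ p ∈ Cfar, ((1 + |yM p|) ^ 2)⁻¹ := by rw [Finset.mul_sum]
      _ ≤ 4 / lam ^ 2 * (CN * (T * L) * (4 / c ^ 2 * (8 * (C₁ * L)))) := by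
          apply mul_le_mul_of_nonneg_left _ (by positivity)
          exact hCfar_sum.trans (mul_le_mul_of_nonneg_right hNT (by positivity))
      _ = 512 * π ^ 2 * CN * C₁ * T / lam ^ 2 := by rw [hc]; field_simp; ring
  -- assemble
  calc ∑ p ∈ Ω \ pairs T M, Φ p
      ≤ (∑ p ∈ A, Φ p + ∑ p ∈ B₁, Φ p) + (∑ p ∈ B₂, Φ p + ∑ p ∈ Cfar, Φ p) := hmain
    _ ≤ (12 * CN * C₀ * T + 8 * C_w * (T * L) / (lam ^ 2 * M)) +
        (24 * C_w / y₀ * (T * L) / (lam ^ 2 * M) + 512 * π ^ 2 * CN * C₁ * T / lam ^ 2) :=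
        add_le_add (add_le_add hAsum hB₁sum) (add_le_add hB₂sum hCsum)
    _ = 12 * CN * C₀ * T + (8 * C_w + 24 * C_w / y₀) * (T * L) / (lam ^ 2 * M) +
        512 * π ^ 2 * CN * C₁ * T / lam ^ 2 := by
        field_simp; ring

/-- `sinc²(πλy) ≤ 4 λ⁻² (1 + |y|)⁻²` for `0 < λ ≤ 1/2` (`|K_λ| ≤ min(1, (λπy)⁻²)`). [folklore] -/
private theorem sinc_sq_le_decay' {lam : ℝ} (hlam : 0 < lam) (hlam2 : lam ≤ 1 / 2) (y : ℝ) :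
    Real.sinc (π * lam * y) ^ 2 ≤ 4 / lam ^ 2 * ((1 + |y|) ^ 2)⁻¹ := by
  have hs1 : Real.sinc (π * lam * y) ^ 2 ≤ 1 := by
    rw [← sq_abs]; exact pow_le_one₀ (abs_nonneg _) (Real.abs_sinc_le_one _)
  have e : 4 / lam ^ 2 * ((1 + |y|) ^ 2)⁻¹ = 4 / (lam ^ 2 * (1 + |y|) ^ 2) := by
    field_simp
  rw [e]
  have h2l : lam ^ 2 ≤ 1 / 4 := by nlinarith
  by_cases hy : |y| ≤ 1
  · refine hs1.trans ?_
    rw [le_div_iff₀ (by positivity), one_mul]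
    have h1 : (1 + |y|) ^ 2 ≤ 4 := by nlinarith [abs_nonneg y]
    nlinarith [mul_le_mul h2l h1 (by positivity) (by positivity)]
  · push Not at hy
    have hy0 : y ≠ 0 := by intro h; rw [h, abs_zero] at hy; linarith
    have hx : π * lam * y ≠ 0 := by positivity
    have h1 : |Real.sinc (π * lam * y)| ≤ (π * lam * |y|)⁻¹ := by
      rw [Real.sinc_of_ne_zero hx, abs_div, abs_mul, abs_mul, abs_of_pos Real.pi_pos, abs_of_pos hlam,
        div_le_iff₀ (by positivity), inv_mul_cancel₀ (by positivity)]
      exact Real.abs_sin_le_one _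
    have h2 : Real.sinc (π * lam * y) ^ 2 ≤ ((π * lam * |y|)⁻¹) ^ 2 := by
      rw [← sq_abs]; exact pow_le_pow_left₀ (abs_nonneg _) h1 2
    refine h2.trans ?_
    rw [inv_pow, inv_eq_one_div, div_le_div_iff₀ (by positivity) (by positivity), one_mul]
    have h3 : (1 + |y|) ^ 2 ≤ 4 * |y| ^ 2 := by nlinarith
    have h5 : lam ^ 2 * (1 + |y|) ^ 2 ≤ lam ^ 2 * (4 * |y| ^ 2) :=
      mul_le_mul_of_nonneg_left h3 (sq_nonneg _)
    have h6 : lam ^ 2 * (4 * |y| ^ 2) ≤ 4 * (π * lam * |y|) ^ 2 := by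
      rw [show 4 * (π * lam * |y|) ^ 2 = π ^ 2 * (lam ^ 2 * (4 * |y| ^ 2)) by ring]
      exact le_mul_of_one_le_left (by positivity) (by nlinarith [Real.pi_gt_three])
    linarith

/-- The final bookkeeping of `heathBrownG_approx_usplit`, isolated (pure arithmetic). [folklore] -/
private theorem usplit_arith {A C u Nm X Y K₁ K₂ c0 c1 c2 t0 t1 t2 t3 t4 π' : ℝ}
    (hA : 2 * π' * (K₁ + K₂) ≤ A) (hC : C = c0 + c1 + c2 + 1) (hu : 0 ≤ u) (hNm : 0 < Nm)
    (hX : 0 ≤ X) (hY : 0 ≤ Y) (hc0 : 0 ≤ c0) (hc1 : 0 ≤ c1) (hc2 : 0 ≤ c2)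
    (h0 : t0 = c0 * Y * Nm) (h1 : t1 = 2 * π' * K₁ * u) (h2 : t2 ≤ 2 * π' * K₂ * u)
    (h3 : t3 = c2 * X * Nm) (h4 : t4 ≤ c1 * Y * Nm) :
    t0 + t1 + t2 + t3 + t4 ≤ (A * (u / Nm) + C * (X + Y)) * Nm := by
  have e1 : (A * (u / Nm) + C * (X + Y)) * Nm = A * u + C * (X + Y) * Nm := by
    field_simp
  rw [e1]
  have p1 : 0 ≤ (A - 2 * π' * (K₁ + K₂)) * u := mul_nonneg (sub_nonneg.mpr hA) hu
  have p2 : 0 ≤ (c0 * X + c1 * X + c2 * Y + X + Y) * Nm := by positivity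
  have e2 : C * (X + Y) * Nm = (c0 * Y + c1 * Y + c2 * X) * Nm +
      (c0 * X + c1 * X + c2 * Y + X + Y) * Nm := by rw [hC]; ring
  nlinarith [p1, p2, e2, h0, h1, h2, h3, h4]

set_option maxHeartbeats 3200000 in
/-- **BGSTB 2025, Lemma 5 (Heath-Brown) (iii) — M-UNIFORM split-constant version of the landed
`AH.heathBrownG_approx` (PROVED, under RH and AH-Pairs).** Source, §5 p. 12: "it is convenient to
condense our main error terms in applying AH-Pairs into the form
`E_G(λ, α) := 1/(λ²M) + (|α|+1)M²R(T) + 1/log T`, where `M`, `T`, and `R(T)` are from AH-Pairs" and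
Lemma 5 (iii) "`G_λ(α) = ∑_{k∈ℤ} e^{iπkα} (sin(λπk/2)/(λπk/2))² P_{k/2} + O(E_G(λ, α))`"; proof p. 13:
"`+ O(1/(λ²M)) + O((|α|+λ)M²R(T)) + O(1/log T)`". OURS (the quantifier bookkeeping the print leaves
implicit): constants SPLIT as `A/(λ²M) + C((|α| + 1)M²R(T) + 1/log T)` with `A` ABSOLUTE — chosen
before `M`, depending only on the RH pair-window constants (`RudnickSarnak.exists_pairCount_window_le`:
Fejér tail over shells started at `Y := max(M, 3y₀)`, far pairs by unit windows in `γ`) and the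
unconditional zero-counting constants — and `C`, chosen after `M`, `R`, `δ`, multiplying only the
`T`-vanishing terms. For every AH-Pairs datum `(M, R)` (`AH.IsPairsRate M R`, any `M > 0`) and bin
half-width `0 < δ ≤ 1/2`: for all large `T`, all `0 < λ ≤ 1/2`, all `α`. The Riemann Hypothesis
enters where the printed proof uses (zeropairbound) (Goldston–Montgomery 1987).
[cite: BaluyotGoldstonSuriajayaTurnageButterbaugh2025, Lemma 5 (iii)] -/
theorem heathBrownG_approx_usplit (hRH : RiemannHypothesis) :
    ∃ A : ℝ, 0 < A ∧ ∀ M : ℝ, 0 < M → ∀ R : ℝ → ℝ, IsPairsRate M R → ∀ δ : ℝ, 0 < δ → δ ≤ 1 / 2 →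
      ∃ C : ℝ, 0 < C ∧ ∀ᶠ T : ℝ in atTop, ∀ lam : ℝ, 0 < lam → lam ≤ 1 / 2 → ∀ α : ℝ,
        ‖(heathBrownG lam α T : ℂ) -
            ∑' k : ℤ, Complex.exp (π * k * α * Complex.I) *
              ((Real.sinc (lam * π * k / 2) ^ 2 * binDensity k T M δ : ℝ) : ℂ)‖ ≤
          A / (lam ^ 2 * M) + C * ((|α| + 1) * M ^ 2 * R T + 1 / Real.log T) := by
  obtain ⟨y₀, hy₀, C_w, hwinE⟩ := RudnickSarnak.exists_pairCount_window_le hRH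
  obtain ⟨C₁, hC₁, hunitE⟩ := RudnickSarnak.eventually_card_filter_zetaOrdinate_window_le
  obtain ⟨C₀, hC₀, hW⟩ := Montgomery.exists_zetaZeroCount_window_le
  obtain ⟨CN, hCN, hN⟩ := exists_zetaZeroCount_le_mul_log
  set Cw : ℝ := max C_w 1 with hCw
  have hCw0 : 0 < Cw := lt_of_lt_of_le one_pos (le_max_right _ _)
  set K₁ : ℝ := 8 * Cw + 24 * Cw / y₀ with hK₁
  have hK₁0 : 0 ≤ K₁ := by positivity
  set K₂ : ℝ := 512 * π ^ 2 * CN * C₁ with hK₂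
  have hK₂0 : 0 ≤ K₂ := by positivity
  refine ⟨2 * π * (K₁ + K₂) + 1, by positivity, ?_⟩
  intro M hM R hR δ hδ hδ2
  obtain ⟨hR0, -, hRlim, C_R, hCR⟩ := hR
  set C' : ℝ := max C_R 1 with hC'
  have hC'0 : 0 < C' := lt_of_lt_of_le one_pos (le_max_right _ _)
  have hC'C : C_R ≤ C' := le_max_left _ _
  set K₀ : ℝ := 12 * CN * C₀ with hK₀
  have hK₀0 : 0 ≤ K₀ := by positivity
  set KP : ℝ := 2 * Cw * (M / y₀ + 1) with hKP
  have hKP0 : 0 ≤ KP := by positivity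
  set N : ℕ := ⌈2 * M + 1⌉₊ with hNdef
  have hN' : 2 * M + 1 ≤ (N : ℝ) := Nat.le_ceil _
  -- the three `M`-dependent constants (they multiply `T`-vanishing quantities only)
  set c0 : ℝ := 2 * π * K₀ with hc0def
  set c1 : ℝ := 2 * π * (π ^ 2 * M ^ 2 * KP) with hc1def
  set c2 : ℝ := 2 * π * (2 * π * C' * (4 * M + 2) * KP / M ^ 2) with hc2def
  have hc00 : 0 ≤ c0 := by positivity
  have hc10 : 0 ≤ c1 := by positivity
  have hc20 : 0 ≤ c2 := by positivity
  set C : ℝ := c0 + c1 + c2 + 1 with hCdef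
  refine ⟨C, by positivity, ?_⟩
  have hρ : Tendsto (fun T ↦ C' * (4 * M + 2) * R T) atTop (𝓝 0) := by
    have := hRlim.const_mul (C' * (4 * M + 2)); rwa [mul_zero] at this
  filter_upwards [hCR, hwinE, hunitE, eventually_ge_atTop (4 : ℝ),
    Real.tendsto_log_atTop.eventually_ge_atTop (2 * π * M),
    Real.tendsto_log_atTop.eventually_ge_atTop (2 * π * (3 * y₀ + 2)),
    Real.tendsto_log_atTop.eventually_ge_atTop (12 * π * y₀),
    Real.tendsto_log_atTop.eventually_ge_atTop (π * ((M / y₀ + 5 / 2) * y₀)),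
    Real.tendsto_log_atTop.eventually_ge_atTop M,
    (RudnickSarnak.tendsto_div_log_sq_atTop).eventually_ge_atTop (1 : ℝ),
    hρ.eventually (gt_mem_nhds (show (0 : ℝ) < δ / 4 by positivity)),
    (hRlim.const_mul C').eventually (gt_mem_nhds (show C' * 0 < 1 / 4 by norm_num))]
    with T hCT hwin hunit hT4 hLM hLy hLy2 hLP hLM' hu1 hρT hR4
  intro lam hlam hlam2 α
  have hT0 : 0 < T := by linarith
  have hT1 : 1 < T := by linarith
  set L : ℝ := Real.log T with hLdef
  have hL : 0 < L := Real.log_pos hT1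
  have hL1 : 1 ≤ L := by nlinarith [Real.pi_gt_three, hy₀]
  set Nm : ℝ := T / (2 * π) * L with hNm
  have hNm0 : 0 < Nm := by positivity
  set Ω := zeroIndexSet T ×ˢ zeroIndexSet T with hΩ
  set r : ℝ → ℂ := fun y ↦ 𝓕 (fun v : ℝ ↦ (fejerTest lam (-α) v : ℂ)) y with hr
  have hr_eq : ∀ y, r y = Complex.exp (↑(2 * π * α * y) * Complex.I) *
      ((Real.sinc (π * lam * y) ^ 2 : ℝ) : ℂ) := by
    intro y; rw [hr]; dsimp only; rw [fourier_fejerTest hlam]; congr 2; push_cast; ring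
  have hr1 : ∀ y, ‖r y‖ ≤ 1 := fun y ↦ norm_fourier_fejerTest_le hlam (-α) y
  have hrlip : ∀ x y, ‖r x - r y‖ ≤ 2 * π * (|α| + 1) * |x - y| := by
    intro x y
    have := norm_fourier_fejerTest_sub_le hlam (by linarith) (-α) x y
    rwa [abs_neg] at this
  have hrdec : ∀ y, ‖r y‖ ≤ 4 / lam ^ 2 * ((1 + |y|) ^ 2)⁻¹ := by
    intro y
    rw [hr_eq, norm_mul, Complex.norm_exp_ofReal_mul_I, one_mul, Complex.norm_real, Real.norm_eq_abs,
      abs_of_nonneg (sq_nonneg _)]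
    exact sinc_sq_le_decay' hlam hlam2 y
  -- window bound with the positive constant `Cw`
  have hwin' : ∀ s : ℝ, |s| + y₀ ≤ Real.log T / π →
      ((Ω.filter fun p ↦ |Real.log T / (2 * π) * (zetaOrdinate p.1 - zetaOrdinate p.2) - s| ≤ y₀).card : ℝ) ≤
        Cw * (T * Real.log T) := by
    intro s hs
    refine (hwin s hs).trans ?_
    exact mul_le_mul_of_nonneg_right (le_max_left _ _) (by positivity)
  -- (0) `G_λ(α) 𝒩 = Σ_Ω r(y) w`
  have h0 := heathBrownG_mul_eq_sum hlam hT1 α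
  rw [← hNm] at h0
  -- (1) the main term is `(Σ_{|k|≤N} r(k/2) |B_{k/2}|)/𝒩`
  have hNmC : (Nm : ℂ) ≠ 0 := Complex.ofReal_ne_zero.mpr hNm0.ne'
  have h1 : ∑' k : ℤ, Complex.exp (π * k * α * Complex.I) *
      ((Real.sinc (lam * π * k / 2) ^ 2 * binDensity k T M δ : ℝ) : ℂ) =
      (∑ k ∈ Finset.Icc (-(N : ℤ)) N, r ((k : ℝ) / 2) * ((bin k T M δ).card : ℂ)) / (Nm : ℂ) := by
    rw [tsum_mul_binDensity_eq_sum (by linarith : δ ≤ 1) hN'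
      (fun k ↦ Complex.exp (π * k * α * Complex.I)) (fun k ↦ Real.sinc (lam * π * k / 2) ^ 2),
      Finset.sum_div]
    refine Finset.sum_congr rfl fun k _ ↦ ?_
    rw [hr_eq, binDensity, ← hLdef, ← hNm]
    have e1 : Complex.exp (π * k * α * Complex.I) = Complex.exp (↑(2 * π * α * ((k : ℝ) / 2)) * Complex.I) := by
      congr 1; push_cast; ring
    have e2 : Real.sinc (lam * π * k / 2) = Real.sinc (π * lam * ((k : ℝ) / 2)) := by
      congr 1; ring
    rw [e1, e2]
    push_cast
    field_simp
  -- (2) localisation of `𝒫(T, M)` near the half-integers, `ρ_T = C'(4M+2)R(T) < δ/4`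
  set ρ : ℝ := C' * (4 * M + 2) * R T with hρdef
  have hρ0 : 0 ≤ ρ := by have := hR0 T; positivity
  have hρδ : ρ < δ / 2 := by have : ρ < δ / 4 := hρT; linarith
  have hloc : ∀ p ∈ pairs T M, ∃ k : ℤ, |pairSpacing T p - (k : ℝ) / 2| ≤ ρ := by
    intro p hp
    obtain ⟨k, hk⟩ := hCT p hp
    refine ⟨k, hk.trans ?_⟩
    have hy : |pairSpacing T p| ≤ M := (mem_pairs.mp hp).2.2.2
    have hRT := hR0 T
    have h1 : C_R * (|(k : ℝ)| + 1) * R T ≤ C' * (|(k : ℝ)| + 1) * R T := by gcongr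
    have hk2 : |(k : ℝ)| / 2 ≤ |pairSpacing T p| + C' * (|(k : ℝ)| + 1) * R T := by
      have := abs_sub_abs_le_abs_sub ((k : ℝ) / 2) (pairSpacing T p)
      rw [abs_sub_comm, abs_div, abs_two] at this
      linarith
    have hR4' : C' * R T < 1 / 4 := hR4
    have hk4 : |(k : ℝ)| ≤ 4 * M + 1 := by
      have hkk : 0 ≤ |(k : ℝ)| := abs_nonneg _
      nlinarith
    calc C_R * (|(k : ℝ)| + 1) * R T ≤ C' * (|(k : ℝ)| + 1) * R T := h1
      _ ≤ C' * (4 * M + 2) * R T := by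
          apply mul_le_mul_of_nonneg_right _ hRT.le
          apply mul_le_mul_of_nonneg_left _ hC'0.le
          linarith
  -- (3) the two error pieces
  set Φ : ℕ × ℕ → ℝ := fun p ↦ ‖r (pairSpacing T p)‖ * montgomeryWeight (zetaOrdinate p.1 - zetaOrdinate p.2)
    with hΦ
  have hΦ0 : ∀ p, 0 ≤ Φ p := fun p ↦ mul_nonneg (norm_nonneg _) (montgomeryWeight_pos _).le
  have hΦle : ∀ p, Φ p ≤ ‖r (pairSpacing T p)‖ := fun p ↦
    mul_le_of_le_one_right (norm_nonneg _) (montgomeryWeight_le_one _)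
  have hΦ1 : ∀ p, Φ p ≤ 1 := fun p ↦ (hΦle p).trans (hr1 _)
  have hΦ2 : ∀ p, Φ p ≤ 4 / lam ^ 2 * ((1 + |pairSpacing T p|) ^ 2)⁻¹ := fun p ↦ (hΦle p).trans (hrdec _)
  have hA := sum_sdiff_pairs_le_usplit hM hlam hy₀ hCw0.le hC₁.le hC₀.le hCN.le hwin' hunit hW hN hT4
    hLM hLy hLy2 hu1 Φ hΦ0 hΦ1 hΦ2
  have hB := norm_sum_pairs_sub_sum_bins_le (δ := δ) hδ2 hρδ hloc hN' hL (Lip := 2 * π * (|α| + 1))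
    (by positivity) hr1 hrlip
  have hLP' : (M / y₀ + 5 / 2) * y₀ ≤ Real.log T / π := by
    rw [le_div_iff₀ Real.pi_pos]; linarith
  have hPcard : ((pairs T M).card : ℝ) ≤ KP * (T * L) := by
    refine (card_pairs_le_window hM.le hy₀ hwin' hLP').trans ?_
    have hfl : (⌊M / y₀⌋₊ : ℝ) ≤ M / y₀ := Nat.floor_le (by positivity)
    rw [hKP, ← hLdef]
    calc 2 * (Cw * (T * L)) * (⌊M / y₀⌋₊ + 1) ≤ 2 * (Cw * (T * L)) * (M / y₀ + 1) := by gcongr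
      _ = 2 * Cw * (M / y₀ + 1) * (T * L) := by ring
  -- (4) assemble
  have hPΩ : pairs T M ⊆ Ω := fun p hp ↦ (mem_pairs.mp hp).1
  have hdiff : ‖∑ p ∈ Ω, r (pairSpacing T p) * (montgomeryWeight (zetaOrdinate p.1 - zetaOrdinate p.2) : ℂ) -
      ∑ p ∈ pairs T M, r (pairSpacing T p) * (montgomeryWeight (zetaOrdinate p.1 - zetaOrdinate p.2) : ℂ)‖ ≤
      K₀ * T + K₁ * (T * L) / (lam ^ 2 * M) + K₂ * T / lam ^ 2 := by
    rw [← Finset.sum_sdiff_eq_sub hPΩ]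
    calc ‖∑ p ∈ Ω \ pairs T M, r (pairSpacing T p) * (montgomeryWeight (zetaOrdinate p.1 - zetaOrdinate p.2) : ℂ)‖
        ≤ ∑ p ∈ Ω \ pairs T M, ‖r (pairSpacing T p) * (montgomeryWeight (zetaOrdinate p.1 - zetaOrdinate p.2) : ℂ)‖ :=
          norm_sum_le _ _
      _ = ∑ p ∈ Ω \ pairs T M, Φ p := by
          refine Finset.sum_congr rfl fun p _ ↦ ?_
          rw [hΦ, norm_mul, Complex.norm_real, Real.norm_eq_abs, abs_of_pos (montgomeryWeight_pos _)]
      _ ≤ 12 * CN * C₀ * T + (8 * Cw + 24 * Cw / y₀) * (T * Real.log T) / (lam ^ 2 * M) +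
            512 * π ^ 2 * CN * C₁ * T / lam ^ 2 := hA
      _ = K₀ * T + K₁ * (T * L) / (lam ^ 2 * M) + K₂ * T / lam ^ 2 := by
          rw [hK₀, hK₁, hK₂, ← hLdef]
  have hmainC : (heathBrownG lam α T : ℂ) -
      ∑' k : ℤ, Complex.exp (π * k * α * Complex.I) *
        ((Real.sinc (lam * π * k / 2) ^ 2 * binDensity k T M δ : ℝ) : ℂ) =
      ((∑ p ∈ Ω, r (pairSpacing T p) * (montgomeryWeight (zetaOrdinate p.1 - zetaOrdinate p.2) : ℂ) -
          ∑ p ∈ pairs T M, r (pairSpacing T p) * (montgomeryWeight (zetaOrdinate p.1 - zetaOrdinate p.2) : ℂ)) +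
        (∑ p ∈ pairs T M, r (pairSpacing T p) * (montgomeryWeight (zetaOrdinate p.1 - zetaOrdinate p.2) : ℂ) -
          ∑ k ∈ Finset.Icc (-(N : ℤ)) N, r ((k : ℝ) / 2) * ((bin k T M δ).card : ℂ))) / (Nm : ℂ) := by
    rw [h1, ← h0]
    push_cast
    field_simp
    ring
  rw [hmainC, norm_div, Complex.norm_real, Real.norm_eq_abs, abs_of_pos hNm0, div_le_iff₀ hNm0]
  -- the five pieces against `(A/(λ²M) + C(X + Y)) 𝒩`
  set X : ℝ := (|α| + 1) * M ^ 2 * R T with hX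
  set Yl : ℝ := 1 / Real.log T with hYl
  have hX0 : 0 ≤ X := by have := hR0 T; positivity
  have hYl0 : 0 ≤ Yl := by positivity
  set uu : ℝ := Nm / (lam ^ 2 * M) with huu
  have huu0 : 0 ≤ uu := by positivity
  have hRT := (hR0 T).le
  have t0 : K₀ * T = c0 * Yl * Nm := by
    rw [hc0def, hYl, hNm, ← hLdef]; field_simp
  have t1 : K₁ * (T * L) / (lam ^ 2 * M) = 2 * π * K₁ * uu := by
    rw [huu, hNm]; field_simp
  have t2 : K₂ * T / lam ^ 2 ≤ 2 * π * K₂ * uu := by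
    rw [huu, hNm]
    rw [show 2 * π * K₂ * (T / (2 * π) * L / (lam ^ 2 * M)) = K₂ * T * (L / M) / lam ^ 2 by
      field_simp]
    have hLM1 : 1 ≤ L / M := by rw [le_div_iff₀ hM, one_mul]; exact hLM'
    rw [div_le_div_iff_of_pos_right (by positivity)]
    calc K₂ * T = K₂ * T * 1 := (mul_one _).symm
      _ ≤ K₂ * T * (L / M) := by gcongr
  have t3 : 2 * π * (|α| + 1) * ρ * (KP * (T * L)) = c2 * X * Nm := by
    rw [hc2def, hX, hρdef, hNm]; field_simp
  have t4 : π ^ 2 * M ^ 2 / L ^ 2 * (KP * (T * L)) ≤ c1 * Yl * Nm := by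
    rw [hc1def, hYl, hNm, ← hLdef,
      show 2 * π * (π ^ 2 * M ^ 2 * KP) * (1 / L) * (T / (2 * π) * L) = π ^ 2 * M ^ 2 * KP * T by
        field_simp,
      show π ^ 2 * M ^ 2 / L ^ 2 * (KP * (T * L)) = π ^ 2 * M ^ 2 * KP * T / L by field_simp]
    exact div_le_self (by positivity) hL1
  have hfin := usplit_arith (π' := π) (A := 2 * π * (K₁ + K₂) + 1) (C := C) (by linarith) hCdef
    huu0 hNm0 hX0 hYl0 hc00 hc10 hc20 t0 t1 t2 t3 t4
  have e : (2 * π * (K₁ + K₂) + 1) * (uu / Nm) = (2 * π * (K₁ + K₂) + 1) / (lam ^ 2 * M) := by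
    rw [huu]; field_simp
  rw [e] at hfin
  calc ‖(∑ p ∈ Ω, r (pairSpacing T p) * (montgomeryWeight (zetaOrdinate p.1 - zetaOrdinate p.2) : ℂ) -
          ∑ p ∈ pairs T M, r (pairSpacing T p) * (montgomeryWeight (zetaOrdinate p.1 - zetaOrdinate p.2) : ℂ)) +
        (∑ p ∈ pairs T M, r (pairSpacing T p) * (montgomeryWeight (zetaOrdinate p.1 - zetaOrdinate p.2) : ℂ) -
          ∑ k ∈ Finset.Icc (-(N : ℤ)) N, r ((k : ℝ) / 2) * ((bin k T M δ).card : ℂ))‖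
      ≤ (K₀ * T + K₁ * (T * L) / (lam ^ 2 * M) + K₂ * T / lam ^ 2) +
          (2 * π * (|α| + 1) * ρ + π ^ 2 * M ^ 2 / L ^ 2) * (pairs T M).card :=
        (norm_add_le _ _).trans (add_le_add hdiff hB)
    _ ≤ (K₀ * T + K₁ * (T * L) / (lam ^ 2 * M) + K₂ * T / lam ^ 2) +
          (2 * π * (|α| + 1) * ρ + π ^ 2 * M ^ 2 / L ^ 2) * (KP * (T * L)) := by
        gcongr
    _ = K₀ * T + K₁ * (T * L) / (lam ^ 2 * M) + K₂ * T / lam ^ 2 +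
          2 * π * (|α| + 1) * ρ * (KP * (T * L)) + π ^ 2 * M ^ 2 / L ^ 2 * (KP * (T * L)) := by ring
    _ ≤ ((2 * π * (K₁ + K₂) + 1) / (lam ^ 2 * M) + C * (X + Yl)) * Nm := hfin

/-! ## U3. Lemma 5 (iii)–(iv) together, with the split constants -/

/-- **BGSTB 2025, Lemma 5 (Heath-Brown), (iii)–(iv) — M-UNIFORM split-constant version of the landed
`bgstb2025_lemma5_ah_of_RH` (PROVED under RH and AH-Pairs; (iv) with `|L|`, the form that "(iv)
follows immediately from (iii)" (p. 13) yields).** Source, §5 p. 12: "`E_G(λ, α) := 1/(λ²M) +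
(|α|+1)M²R(T) + 1/log T`, where `M`, `T`, and `R(T)` are from AH-Pairs"; "(iv)
`G_λ(α+2L) = G_λ(α) + O(E_G(λ,|α|+2L))`". OURS: there is an ABSOLUTE `A > 0` (chosen before `M`) such
that for every AH-Pairs datum `(M, R)` and `0 < δ ≤ 1/2` there is `C > 0` (after `M`, `R`, `δ`;
it multiplies only `T`-vanishing terms) with, for all large `T`, all `0 < λ ≤ 1/2`, all `α`:
`‖G_λ(α) − ∑_k e^{iπkα} sinc²(λπk/2) P_{k/2}‖ ≤ A/(λ²M) + C((|α| + 1)M²R(T) + 1/log T)` and, for every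
`L ∈ ℤ`, `|G_λ(α + 2L) − G_λ(α)| ≤ A/(λ²M) + C((|α| + 2|L| + 1)M²R(T) + 1/log T)`.
[cite: BaluyotGoldstonSuriajayaTurnageButterbaugh2025, Lemma 5 (iii)–(iv)] -/
theorem _root_.Literature.NumberTheory.LFunctions.bgstb2025_lemma5_ah_usplit (hRH : RiemannHypothesis) :
    ∃ A : ℝ, 0 < A ∧ ∀ M : ℝ, 0 < M → ∀ R : ℝ → ℝ, IsPairsRate M R → ∀ δ : ℝ, 0 < δ → δ ≤ 1 / 2 →
      ∃ C : ℝ, 0 < C ∧ ∀ᶠ T : ℝ in atTop, ∀ lam : ℝ, 0 < lam → lam ≤ 1 / 2 → ∀ α : ℝ,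
        ‖(heathBrownG lam α T : ℂ) -
            ∑' k : ℤ, Complex.exp (π * k * α * Complex.I) *
              ((Real.sinc (lam * π * k / 2) ^ 2 * binDensity k T M δ : ℝ) : ℂ)‖ ≤
          A / (lam ^ 2 * M) + C * ((|α| + 1) * M ^ 2 * R T + 1 / Real.log T) ∧
        ∀ L : ℤ, |heathBrownG lam (α + 2 * L) T - heathBrownG lam α T| ≤
          A / (lam ^ 2 * M) + C * ((|α| + 2 * |(L : ℝ)| + 1) * M ^ 2 * R T + 1 / Real.log T) := by
  obtain ⟨A, hA, h⟩ := heathBrownG_approx_usplit hRH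
  refine ⟨2 * A, by positivity, ?_⟩
  intro M hM R hR δ hδ hδ2
  have hR0 : ∀ T, 0 < R T := hR.1
  obtain ⟨C, hC, hT⟩ := h M hM R hR δ hδ hδ2
  refine ⟨2 * C, by positivity, ?_⟩
  filter_upwards [hT, eventually_gt_atTop (1 : ℝ)] with T hT hT1
  intro lam hlam hlam2 α
  have hlog : 0 < Real.log T := Real.log_pos hT1
  have hRT := (hR0 T).le
  have hu : 0 ≤ A / (lam ^ 2 * M) := by positivity
  have hX : 0 ≤ M ^ 2 * R T := by positivity
  have hY : 0 ≤ 1 / Real.log T := by positivity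
  refine ⟨(hT lam hlam hlam2 α).trans ?_, fun L ↦ ?_⟩
  · have : 0 ≤ C * ((|α| + 1) * M ^ 2 * R T + 1 / Real.log T) := by positivity
    rw [show 2 * A / (lam ^ 2 * M) = 2 * (A / (lam ^ 2 * M)) by ring]
    linarith
  set S : ℂ := ∑' k : ℤ, Complex.exp (π * k * α * Complex.I) *
    ((Real.sinc (lam * π * k / 2) ^ 2 * binDensity k T M δ : ℝ) : ℂ) with hS
  have hper : ∑' k : ℤ, Complex.exp (π * k * ((α + 2 * (L : ℝ) : ℝ) : ℂ) * Complex.I) *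
      ((Real.sinc (lam * π * k / 2) ^ 2 * binDensity k T M δ : ℝ) : ℂ) = S := by
    rw [hS]
    refine tsum_congr fun k ↦ ?_
    congr 1
    rw [show (π : ℂ) * k * ((α + 2 * (L : ℝ) : ℝ) : ℂ) * Complex.I =
        π * k * α * Complex.I + ((k * L : ℤ) : ℂ) * (2 * π * Complex.I) by push_cast; ring,
      Complex.exp_add, Complex.exp_int_mul_two_pi_mul_I, mul_one]
  have h1 := hT lam hlam hlam2 (α + 2 * L)
  have h2 := hT lam hlam hlam2 α
  rw [hper] at h1
  have hdiff : ((heathBrownG lam (α + 2 * L) T - heathBrownG lam α T : ℝ) : ℂ) =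
      ((heathBrownG lam (α + 2 * L) T : ℂ) - S) - ((heathBrownG lam α T : ℂ) - S) := by
    push_cast; ring
  have hn : |heathBrownG lam (α + 2 * L) T - heathBrownG lam α T| ≤
      (A / (lam ^ 2 * M) + C * ((|α + 2 * (L : ℝ)| + 1) * M ^ 2 * R T + 1 / Real.log T)) +
        (A / (lam ^ 2 * M) + C * ((|α| + 1) * M ^ 2 * R T + 1 / Real.log T)) := by
    rw [← Real.norm_eq_abs, ← Complex.norm_real, hdiff]
    exact (norm_sub_le _ _).trans (add_le_add h1 h2)
  refine hn.trans ?_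
  have habs : |α + 2 * (L : ℝ)| ≤ |α| + 2 * |(L : ℝ)| := by
    calc |α + 2 * (L : ℝ)| ≤ |α| + |2 * (L : ℝ)| := abs_add_le _ _
      _ = |α| + 2 * |(L : ℝ)| := by rw [abs_mul, abs_two]
  have hL0 : 0 ≤ |(L : ℝ)| := abs_nonneg _
  have p1 : (|α + 2 * (L : ℝ)| + 1) * M ^ 2 * R T ≤ (|α| + 2 * |(L : ℝ)| + 1) * M ^ 2 * R T := by
    gcongr
  have p2 : (|α| + 1) * M ^ 2 * R T ≤ (|α| + 2 * |(L : ℝ)| + 1) * M ^ 2 * R T := by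
    gcongr; linarith
  have q1 := mul_le_mul_of_nonneg_left p1 hC.le
  have q2 := mul_le_mul_of_nonneg_left p2 hC.le
  rw [show 2 * A / (lam ^ 2 * M) = 2 * (A / (lam ^ 2 * M)) by ring]
  nlinarith [q1, q2, hY, hC.le]

/-! ## U4. Repackaging as ONE `E_G` with rescaled parameters (for proofs written against `E_G`) -/

/-- **Rescaling inequality for `E_G`:** for `T > 1`,
`A/(λ²M) + C((|β| + 1)M²R + 1/log T) ≤ E_G'(λ, β) := 1/(λ²M') + (|β| + 1)M'²R' + 1/log T` at the
rescaled level `M' = M/A` and rate `R' = CA²(1 + 1/M²)(R + 1/log T)` — so a proof written against the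
hypothesis shape `C₂ · AH.errG M (R T) T λ β` runs verbatim on the split bound with `C₂ = 1` (an
ABSOLUTE constant), the `M`-dependence being carried by the `T`-vanishing rate `R'` alone.
[cite: BaluyotGoldstonSuriajayaTurnageButterbaugh2025, §5 (E_G)] -/
theorem split_le_errG_one {A C M lam RT T : ℝ} (hA : 0 < A) (hC : 0 < C) (hM : 0 < M)
    (hlam : 0 < lam) (hRT : 0 ≤ RT) (hT : 1 < T) (β : ℝ) :
    A / (lam ^ 2 * M) + C * ((|β| + 1) * M ^ 2 * RT + 1 / Real.log T) ≤
      errG (M / A) (C * A ^ 2 * (1 + 1 / M ^ 2) * (RT + 1 / Real.log T)) T lam β := by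
  have hlog : 0 < Real.log T := Real.log_pos hT
  have e : errG (M / A) (C * A ^ 2 * (1 + 1 / M ^ 2) * (RT + 1 / Real.log T)) T lam β =
      A / (lam ^ 2 * M) + C * (M ^ 2 + 1) * (|β| + 1) * (RT + 1 / Real.log T) + 1 / Real.log T := by
    unfold errG
    generalize 1 / Real.log T = Y
    field_simp
  rw [e]
  have hb : 0 ≤ |β| := abs_nonneg β
  have hY0 : 0 ≤ 1 / Real.log T := by positivity
  nlinarith [mul_nonneg (mul_nonneg hC.le hb) (mul_nonneg (sq_nonneg M) hY0),
    mul_nonneg hC.le (mul_nonneg (sq_nonneg M) hY0), mul_nonneg (mul_nonneg hC.le hb) hRT,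
    mul_nonneg hC.le hRT, mul_nonneg (mul_nonneg hC.le hb) hY0, hY0]

/-- **Lemma 5 (iii)–(iv), M-uniform, in `E_G`-form with rescaled parameters and ABSOLUTE leading
constant `1`:** there is an absolute `A > 0` such that for every AH-Pairs datum `(M, R)` and
`0 < δ ≤ 1/2` there is `C > 0` with, for all large `T`, all `0 < λ ≤ 1/2` and all `α`,
`‖G_λ(α) − ∑_k …‖ ≤ E_G'(λ, α)` and `|G_λ(α + 2L) − G_λ(α)| ≤ E_G'(λ, |α| + 2|L|)`, where
`E_G' = AH.errG (M/A) (C (R(T) + 1/log T)) T λ ·` — exactly the hypothesis shape of the tree's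
Corollary-5 / Lemma-6 proofs (`C₂ · AH.errG M (R T) …` with `C₂ = 1`), at the level `M' = M/A` and the
`T`-vanishing rate `R' = C(R + 1/log T)`; unpacked, `E_G'(λ, β) = A/(λ²M) + C(|β| + 1)(M/A)²(R(T) + 1/log T)
+ 1/log T`. OURS (quantifier bookkeeping; source §5 p. 12 (E_G), Lemma 5 (iii)–(iv)).
[cite: BaluyotGoldstonSuriajayaTurnageButterbaugh2025, Lemma 5 (iii)–(iv)] -/
theorem _root_.Literature.NumberTheory.LFunctions.bgstb2025_lemma5_ah_usplit_errG
    (hRH : RiemannHypothesis) :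
    ∃ A : ℝ, 0 < A ∧ ∀ M : ℝ, 0 < M → ∀ R : ℝ → ℝ, IsPairsRate M R → ∀ δ : ℝ, 0 < δ → δ ≤ 1 / 2 →
      ∃ C : ℝ, 0 < C ∧ ∀ᶠ T : ℝ in atTop, ∀ lam : ℝ, 0 < lam → lam ≤ 1 / 2 → ∀ α : ℝ,
        ‖(heathBrownG lam α T : ℂ) -
            ∑' k : ℤ, Complex.exp (π * k * α * Complex.I) *
              ((Real.sinc (lam * π * k / 2) ^ 2 * binDensity k T M δ : ℝ) : ℂ)‖ ≤
          errG (M / A) (C * (R T + 1 / Real.log T)) T lam α ∧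
        ∀ L : ℤ, |heathBrownG lam (α + 2 * L) T - heathBrownG lam α T| ≤
          errG (M / A) (C * (R T + 1 / Real.log T)) T lam (|α| + 2 * |(L : ℝ)|) := by
  obtain ⟨A, hA, h⟩ := bgstb2025_lemma5_ah_usplit hRH
  refine ⟨A, hA, ?_⟩
  intro M hM R hR δ hδ hδ2
  have hR0 : ∀ T, 0 < R T := hR.1
  obtain ⟨C, hC, hT⟩ := h M hM R hR δ hδ hδ2
  refine ⟨C * A ^ 2 * (1 + 1 / M ^ 2), by positivity, ?_⟩
  filter_upwards [hT, eventually_gt_atTop (1 : ℝ)] with T hT hT1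
  intro lam hlam hlam2 α
  obtain ⟨h1, h2⟩ := hT lam hlam hlam2 α
  refine ⟨h1.trans (split_le_errG_one hA hC hM hlam (hR0 T).le hT1 α), fun L ↦ (h2 L).trans ?_⟩
  have h := split_le_errG_one hA hC hM hlam (hR0 T).le hT1 (|α| + 2 * |(L : ℝ)|)
  rwa [abs_of_nonneg (by positivity : (0 : ℝ) ≤ |α| + 2 * |(L : ℝ)|)] at h

end AH

end Literature.NumberTheory.LFunctions

end
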